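import Summits.AnomalousDissipation.AnomalousDissipation.Theorems.TwohalfdNeg.Negative.SweptThreshold

/-!
# Negative knowledge for the crux `TwohalfdNeg` (stmt-AnomalousDissipation-0211), VI: the momentum/energy threshold
# table of the explicit families

Certified copy of the tail of §7 of the cdisprove work file `Cruxes/TwohalfdNeg/Disproof.lean` (cycle 2).  Rows:
(1) fixed drift `m ≠ 0` — the swept states `sweptState m (sweptAmp ν m)` are ADMISSIBLE for the crux
(`meanEnergy ≤ m² + 1/(8π²m²)` uniformly in `ν`, `meanEnergy_swept_fixedDrift_le`) and dissipate `≤ ν/(2m²)`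
(`meanDissipation_swept_fixedDrift_le`; the vertical-force `2½`-D twin of
`Literature.Barriers.AnomalousDissipation.meanDissipation_marchioroSweptState_le`): sweeping is consistent with the
crux, rate `ν`; (2) drift `√ν_j` — ceiling `E/ν_j` is FALSE (`twohalfdNeg_false_energyInvNu`, `SweptThreshold.lean`);
(3) ZERO planar momentum (`HasZeroMean (u₀ j)`) — ceiling `E/ν_j²` is FALSE by the laminar witness of
`LoadBearing.lean` (`twohalfdNeg_false_zeroMomentum_energyInvNuSq`).  No explicit family reaches below `E ~ ν⁻²` at
zero momentum; whether the zero-momentum crux already fails at `E ~ ν^{-a}`, `a < 2`, is open.  Supports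
stmt-AnomalousDissipation-0211.
-/

noncomputable section

namespace Summit.AnomalousDissipation.AnomalousDissipation.Theorems.TwohalfdNeg.Negative

open MeasureTheory Set Filter Topology UnitAddTorus
open scoped ENNReal NNReal InnerProductSpace ComplexConjugate
open Literature.Analysis.FunctionSpaces Literature.Analysis.FunctionSpaces.Torus
open Literature.Analysis.FluidPDE Literature.Analysis.FluidPDE.Torus

section ThresholdTable

/-- **At FIXED drift the swept family is admissible and dissipates `O(ν)`** (the `2½`-D, vertical-force twin of
`Literature.Barriers.AnomalousDissipation.meanDissipation_marchioroSweptState_le`): for `m ≠ 0`,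
`meanDissipation = 2π²ν/(16π⁴ν² + 4π²m²) ≤ ν/(2m²)`.  So Galilean sweeping at bounded energy is consistent with the
crux (rate `ν`); only the drift `m ~ √ν` of `twohalfdNeg_false_energyInvNu` trades energy `O(ν⁻¹)` for `O(1)`
dissipation. [folklore] -/
theorem meanDissipation_swept_fixedDrift_le {ν m : ℝ} (hν : 0 ≤ ν) (hm : m ≠ 0) :
    meanDissipation ν (fun _ : ℝ => sweptState m (sweptAmp ν m)) ≤ ν / (2 * m ^ 2) := by
  rw [meanDissipation_sweptState, norm_sq_sweptAmp]
  have hm2 : 0 < m ^ 2 := by positivity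
  have h1 : 8 * Real.pi ^ 2 * (1 / 4 / ((4 * Real.pi ^ 2 * ν) ^ 2 + (2 * Real.pi * m) ^ 2)) ≤ 1 / (2 * m ^ 2) := by
    rw [← mul_div_assoc, div_le_div_iff₀ (by positivity) (by positivity)]
    nlinarith [sq_nonneg (4 * Real.pi ^ 2 * ν), Real.pi_pos, sq_nonneg (Real.pi * m)]
  calc ν * (8 * Real.pi ^ 2 * (1 / 4 / ((4 * Real.pi ^ 2 * ν) ^ 2 + (2 * Real.pi * m) ^ 2)))
      ≤ ν * (1 / (2 * m ^ 2)) := mul_le_mul_of_nonneg_left h1 hν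
    _ = ν / (2 * m ^ 2) := by ring

/-- **At FIXED drift the swept family has `ν`-uniformly bounded energy**: `meanEnergy ≤ m² + 1/(8π²m²)`. [folklore] -/
theorem meanEnergy_swept_fixedDrift_le (ν : ℝ) {m : ℝ} (hm : m ≠ 0) :
    meanEnergy (fun _ : ℝ => sweptState m (sweptAmp ν m)) ≤ m ^ 2 + 1 / (8 * Real.pi ^ 2 * m ^ 2) := by
  rw [meanEnergy_sweptState, norm_sq_sweptAmp]
  have hm2 : 0 < m ^ 2 := by positivity
  have h1 : 2 * (1 / 4 / ((4 * Real.pi ^ 2 * ν) ^ 2 + (2 * Real.pi * m) ^ 2)) ≤ 1 / (8 * Real.pi ^ 2 * m ^ 2) := by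
    rw [← mul_div_assoc, div_le_div_iff₀ (by positivity) (by positivity)]
    nlinarith [sq_nonneg (4 * Real.pi ^ 2 * ν), Real.pi_pos, sq_nonneg (Real.pi * m)]
  linarith

/-- `TwohalfdNeg` at ZERO PLANAR MOMENTUM (`HasZeroMean (u₀ j)`, as in crux #3 `TwodBoundedEnergyZeroMomentum`) with the
energy ceiling relaxed to `O(ν_j⁻²)`: `∃ E, ∀ j, meanEnergy (u j) ≤ E / ν j ^ 2`. -/
def TwohalfdNegZeroMomentumEnergyInvNuSq : Prop :=
  ∀ f : (UnitAddTorus (Fin 3)) → (EuclideanSpace ℝ (Fin 3)), (∀ (s : UnitAddCircle) (x : (UnitAddTorus (Fin 3))), f (x + Pi.single (2 : Fin 3) s) = f x) →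
    IsSmooth f → IsDivFree f → HasZeroMean f →
    ∀ (ν : ℕ → ℝ) (u₀ : ℕ → (UnitAddTorus (Fin 3)) → (EuclideanSpace ℝ (Fin 3))) (u : ℕ → ℝ → (UnitAddTorus (Fin 3)) → (EuclideanSpace ℝ (Fin 3))),
      (∀ j, 0 < ν j) → Tendsto ν atTop (𝓝 0) →
      (∀ j, HasZeroMean (u₀ j)) →
      (∀ j, IsGlobalLerayHopf (ν j) (fun _ => f) (u₀ j) (u j)) →
      (∀ j (t : ℝ) (s : UnitAddCircle) (x : (UnitAddTorus (Fin 3))), u j t (x + Pi.single (2 : Fin 3) s) = u j t x) →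
      (∃ E : ℝ, ∀ j, meanEnergy (u j) ≤ E / ν j ^ 2) →
      Tendsto (fun j => meanDissipation (ν j) (u j)) atTop (𝓝 0)

/-- **THRESHOLD TABLE, zero-momentum row.**  At zero planar momentum the laminar witness of §4 (`u_j = f/(4π²ν_j)`,
mean zero) has energy `1/(32π⁴ν_j²)` and dissipation `1/(8π²ν_j)·ν_j… = (j+1)/(8π²)`: the zero-momentum crux with
ceiling `E/ν_j²` is FALSE.  Together with `twohalfdNeg_false_energyInvNu` (momentum `√ν_j`, ceiling `E/ν_j`) and
`meanDissipation_swept_fixedDrift_le` (momentum `O(1)`, bounded energy, dissipation `O(ν)`): every explicit row trades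
momentum for energy, and NO explicit family reaches below `E ~ ν⁻²` at zero momentum — whether the zero-momentum crux
is already false at `E ~ ν^{-a}`, `a < 2`, is open (it needs planar stirring sustained by the fixed force). [folklore] -/
theorem twohalfdNeg_false_zeroMomentum_energyInvNuSq : ¬ TwohalfdNegZeroMomentumEnergyInvNuSq := by
  intro h
  have hν : ∀ j : ℕ, (0 : ℝ) < 1 / ((j : ℝ) + 1) := fun j => by positivity
  have hb : ∀ j : ℕ, (1 : ℝ) =
      4 * Real.pi ^ 2 * (((0 : ℕ) : ℝ) + 1) ^ 2 * (1 / ((j : ℝ) + 1)) * (((j : ℝ) + 1) / (4 * Real.pi ^ 2)) := by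
    intro j
    have hj : (j : ℝ) + 1 ≠ 0 := by positivity
    have hπ : (Real.pi : ℝ) ^ 2 ≠ 0 := by positivity
    field_simp
    simp
  have ht := h (shear 0 1) (shear_add_single 0 1) (isSmooth_shear 0 1) (isDivFree_shear 0 1)
    (hasZeroMean_shear 0 1) (fun j => 1 / ((j : ℝ) + 1))
    (fun j => shear 0 (((j : ℝ) + 1) / (4 * Real.pi ^ 2)))
    (fun j _ => shear 0 (((j : ℝ) + 1) / (4 * Real.pi ^ 2))) hν
    tendsto_one_div_add_atTop_nhds_zero_nat (fun j => hasZeroMean_shear 0 _)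
    (fun j => isGlobalLerayHopf_shear 0 (hb j)) (fun j _ s x => shear_add_single 0 _ s x)
    ⟨1 / (32 * Real.pi ^ 4), fun j => by
      rw [meanEnergy_shear]
      have hj : (0 : ℝ) < (j : ℝ) + 1 := by positivity
      have hπ : (0 : ℝ) < Real.pi ^ 2 := by positivity
      rw [show (((j : ℝ) + 1) / (4 * Real.pi ^ 2)) ^ 2 / 2 = 1 / (32 * Real.pi ^ 4) / (1 / ((j : ℝ) + 1)) ^ 2 by
        field_simp; ring]⟩
  refine not_tendsto_zero_of_le (c := 1 / (8 * Real.pi ^ 2)) (by positivity) (fun j => ?_) ht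
  rw [meanDissipation_shear]
  have hj : (0 : ℝ) < (j : ℝ) + 1 := by positivity
  have hπ : (0 : ℝ) < Real.pi ^ 2 := by positivity
  have heq : 1 / ((j : ℝ) + 1) * (2 * Real.pi ^ 2 * (((0 : ℕ) : ℝ) + 1) ^ 2 *
      (((j : ℝ) + 1) / (4 * Real.pi ^ 2)) ^ 2) = ((j : ℝ) + 1) / (8 * Real.pi ^ 2) := by
    field_simp
    simp
    ring
  rw [heq]
  exact div_le_div_of_nonneg_right (by linarith) (by positivity)

end ThresholdTable

end Summit.AnomalousDissipation.AnomalousDissipation.Theorems.TwohalfdNeg.Negative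

end
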